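import Mathlib

/-!
# Tier4/Line1/PlacesFinite — a non-zero element of a number field is a unit at all but finitely many finite places
(rung C7.2b of t4-L1-p1 g2's cut of C7.2, S13090; Mathlib only)

Blind re-derivation cell `pub-hodge-repro`, Tier 4 (README §9–§10), seat t4-L2-p2 (gen 2); target tree path
`lean/Summits/Ventures/HodgeRepro/Tier4/Line1/PlacesFinite.lean`.

For `a ∈ k^×` the finite places `v` of `k` at which `a` is NOT a unit of `𝓞_v` — i.e. at which `a ∉ 𝓞_v` or
`a⁻¹ ∉ 𝓞_v` (read in `k_v` through `algebraMap k (v.adicCompletion k)`) — are finitely many: the diagonal image of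
`a` in the finite adele ring is, by the definition of the restricted product, integral at all but finitely many
places (`(algebraMap k (FiniteAdeleRing (𝓞 k) k) a).2`, `Filter.eventually_cofinite`), and so is that of `a⁻¹`.
The `Finset` form `exists_finset_isUnit_outside` gives, for a finite set of non-zero elements, one finite set of
places outside which all of them are units (C7.2's exceptional set `S₀`: the entries of `B`, `Ω`, `v₀`, and `d`,
`det B`, `β(v₀, v₀)`, `2`).  No printed input.

Nothing here asserts anything about the Hodge conjecture for CM abelian varieties, which is NOT proved (HC_CM is NOT
proved by anyone in this repository).
-/

set_option autoImplicit false

noncomputable section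

namespace Summit.Ventures.HodgeRepro.Tier4.Line1

open NumberField IsDedekindDomain HeightOneSpectrum

section PlacesFinite

variable {k : Type} [Field k] [NumberField k]

/-- **`a` is integral at all but finitely many finite places.** -/
theorem finite_setOf_not_mem_adicCompletionIntegers (a : k) :
    {v : HeightOneSpectrum (𝓞 k) | algebraMap k (v.adicCompletion k) a ∉ v.adicCompletionIntegers k}.Finite := by
  have h : ∀ᶠ v : HeightOneSpectrum (𝓞 k) in Filter.cofinite,
      (algebraMap k (FiniteAdeleRing (𝓞 k) k) a) v ∈ v.adicCompletionIntegers k :=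
    (algebraMap k (FiniteAdeleRing (𝓞 k) k) a).2
  have h' : ∀ᶠ v : HeightOneSpectrum (𝓞 k) in Filter.cofinite,
      algebraMap k (v.adicCompletion k) a ∈ v.adicCompletionIntegers k := h
  exact Filter.eventually_cofinite.1 h'

/-- **`a ≠ 0` is a unit of `𝓞_v` at all but finitely many finite places**: the set of `v` with `a ∉ 𝓞_v` or
`a⁻¹ ∉ 𝓞_v` is finite. -/
theorem finite_setOf_not_isUnit (a : k) :
    {v : HeightOneSpectrum (𝓞 k) | ¬ (algebraMap k (v.adicCompletion k) a ∈ v.adicCompletionIntegers k ∧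
      algebraMap k (v.adicCompletion k) a⁻¹ ∈ v.adicCompletionIntegers k)}.Finite := by
  have h1 := finite_setOf_not_mem_adicCompletionIntegers (k := k) a
  have h2 := finite_setOf_not_mem_adicCompletionIntegers (k := k) a⁻¹
  refine (h1.union h2).subset fun v hv => ?_
  simp only [Set.mem_setOf_eq, not_and_or] at hv
  simp only [Set.mem_union, Set.mem_setOf_eq]
  exact hv

/-- **The exceptional set of a finite family**: for a finite set `s` of elements of `k` there is a finite set `S₀` of
finite places outside which every `a ∈ s` and every `a⁻¹` (`a ∈ s`) is `v`-integral. -/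
theorem exists_finset_isUnit_outside (s : Finset k) :
    ∃ S₀ : Finset (HeightOneSpectrum (𝓞 k)), ∀ v ∉ S₀, ∀ a ∈ s,
      algebraMap k (v.adicCompletion k) a ∈ v.adicCompletionIntegers k ∧
        algebraMap k (v.adicCompletion k) a⁻¹ ∈ v.adicCompletionIntegers k := by
  classical
  have hfin : (⋃ a ∈ s, {v : HeightOneSpectrum (𝓞 k) |
      ¬ (algebraMap k (v.adicCompletion k) a ∈ v.adicCompletionIntegers k ∧
        algebraMap k (v.adicCompletion k) a⁻¹ ∈ v.adicCompletionIntegers k)}).Finite :=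
    s.finite_toSet.biUnion fun a _ => finite_setOf_not_isUnit a
  refine ⟨hfin.toFinset, fun v hv a ha => ?_⟩
  rw [Set.Finite.mem_toFinset, Set.mem_iUnion₂] at hv
  by_contra hcon
  exact hv ⟨a, ha, hcon⟩

/-- The same for a finite family given as a function on a finite type (e.g. the entries of a matrix). -/
theorem exists_finset_isUnit_outside_of_fintype {ι : Type*} [Fintype ι] (f : ι → k) :
    ∃ S₀ : Finset (HeightOneSpectrum (𝓞 k)), ∀ v ∉ S₀, ∀ i,
      algebraMap k (v.adicCompletion k) (f i) ∈ v.adicCompletionIntegers k ∧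
        algebraMap k (v.adicCompletion k) (f i)⁻¹ ∈ v.adicCompletionIntegers k := by
  classical
  obtain ⟨S₀, hS₀⟩ := exists_finset_isUnit_outside (Finset.univ.image f)
  exact ⟨S₀, fun v hv i => hS₀ v hv (f i) (Finset.mem_image_of_mem f (Finset.mem_univ i))⟩

end PlacesFinite

end Summit.Ventures.HodgeRepro.Tier4.Line1

end
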